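import Mathlib
import Summits.Ventures.HodgeRepro.Tier4.LitLocalTheta
import Summits.Ventures.HodgeRepro.Tier4.LitHeckeLValue

/-!
# Tier4/LitLiftBridge — `liftNonzero τ` from its printed inputs, at the level of ONE `τ` (L1.7 / (RTF-L) shape)

Blind re-derivation cell `pub-hodge-repro`, Tier 4, seat `t4-lit-6` (gen 0).  Target tree path
`lean/Summits/Ventures/HodgeRepro/Tier4/LitLiftBridge.lean`.  NO published theorem is proved here; the theorems are
compositions of the named Props of `PeriodCloserC7Lift.lean` (night-2: `GQT14_Thm3`), `Tier4/LitLocalTheta.lean`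
(Gan–Ichino 2016 Thm 4.4, Mínguez 2008 Thm 1) and `Tier4/LitHeckeLValue.lean` (Iwasawa 1964 Prop 4.4), shaped for
L1's pin `Pins.lift : Admissible τ → liftNonzero τ` (t4-plan-1, Skeleton v0.3 L555) and night-2's `E5_of_lift`:
`liftNonzero τ = thetaNonzero τ ∧ holomorphicType τ` (`LiftInterface.liftNonzero_iff`), `thetaNonzero τ` from the
local–global criterion with every local lift non-zero and the edge value non-zero.  What a line must still supply for
its `τ`: the dodging of the parameter condition at the non-split finite places (`ParamContainsChiV`), the archimedean
local lifts and the `(2,0)` `K`-type (`holomorphicType`, t4-lit-2's family), and the factorisation of the edge value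
(`EdgeFactorization`).  Nothing here says anything about the status of the Hodge conjecture for CM abelian
varieties, which is NOT proved.
-/

set_option autoImplicit false

noncomputable section

namespace Summit.Ventures.HodgeRepro.Tier4.Lit

open NumberField
open Summit.Ventures.HodgeRepro.PeriodCloser

variable {L : Type} [Field L] [NumberField L] [IsCMField L]

/-- Composition: every local lift of ONE `τ` is non-zero from the printed local statements, given the two `τ`-level
hypotheses (parameter dodged at the non-split finite places; archimedean lifts non-zero). -/
theorem localLifts_of_printed (I : C7Face L) (J : LiftInterface I) (T : LocalThetaInterface I J)
    (hGI : GanIchino2016_Thm4_4_i I J T) (hMi : Minguez2008_Thm1_split I J T) (τ : I.Tau)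
    (hdodge : ∀ v : I.Place, ¬ T.IsArch v → ¬ I.IsSplit v → ¬ T.ParamContainsChiV v τ)
    (harch : ∀ v : I.Place, T.IsArch v → J.localLiftNonzero v τ) :
    ∀ v : I.Place, J.localLiftNonzero v τ := by
  intro v
  by_cases ha : T.IsArch v
  · exact harch v ha
  · by_cases hs : I.IsSplit v
    · exact hMi v ha hs τ
    · exact (hGI v ha hs τ (hdodge v ha hs)).1

/-- Composition: `liftNonzero τ` from GQT14 Thm 3 (night-2's typing), every local lift non-zero, the edge value
non-zero and the `(2,0)` `K`-type. -/
theorem liftNonzero_of_localLifts_edge_hol (I : C7Face L) (J : LiftInterface I) (hG : GQT14_Thm3 I J) (τ : I.Tau)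
    (hloc : ∀ v : I.Place, J.localLiftNonzero v τ) (hedge : J.edgeLValue τ ≠ 0) (hhol : J.holomorphicType τ) :
    I.liftNonzero τ :=
  (J.liftNonzero_iff τ).mpr ⟨(hG τ).mpr ⟨hloc, hedge⟩, hhol⟩

/-- **The L1.7 shape from the printed inputs**: for ONE `τ` with the parameter dodged at the non-split finite places,
non-zero archimedean lifts and the `(2,0)` `K`-type, `liftNonzero τ` follows from GQT14 Thm 3, Gan–Ichino Thm 4.4 (i),
Mínguez Thm 1, Iwasawa Prop 4.4 and the edge factorisation. -/
theorem liftNonzero_of_printed (I : C7Face L) (J : LiftInterface I) (T : LocalThetaInterface I J)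
    (H : HeckeLInterface I) (hG : GQT14_Thm3 I J) (hGI : GanIchino2016_Thm4_4_i I J T)
    (hMi : Minguez2008_Thm1_split I J T) (h44 : Iwasawa1964_Prop4_4 I H) (hfac : EdgeFactorization I J H)
    (τ : I.Tau) (hdodge : ∀ v : I.Place, ¬ T.IsArch v → ¬ I.IsSplit v → ¬ T.ParamContainsChiV v τ)
    (harch : ∀ v : I.Place, T.IsArch v → J.localLiftNonzero v τ) (hhol : J.holomorphicType τ) :
    I.liftNonzero τ :=
  liftNonzero_of_localLifts_edge_hol I J hG τ (localLifts_of_printed I J T hGI hMi τ hdodge harch)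
    (edgeLValue_ne_zero_of_factorization I J H h44 hfac τ) hhol

end Summit.Ventures.HodgeRepro.Tier4.Lit

end
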